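import Literature.Geometry.Symplectic.PuncturedDiscClosedOneForm
import HarnessLib

/-!
# McLean's fibre model: `(r²/2 + κ) dϑ` on the punctured plane and the field `-2∂_ϑ`

Topic `Literature/Geometry/Symplectic`; proofs file (layer "fibre model") of the fact seat of
`Literature.Geometry.Symplectic.mclean_divisorComplement_convex_four` (M. McLean, *The growth
rate of symplectic homology and affine varieties*, GAFA 22 (2012), Lemma 5.17), continuing
`PuncturedDiscClosedOneForm.lean` (the angular form `dϑ_x = Im(x⁻¹ ·) = d arg`).

The end of the printed proof of Lemma 5.17 (p. 37 of arXiv:1011.2542v3) is a computation on one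
fibre `𝔻_ε ⊂ ℂ` of the tube of the divisor, carrying the standard area form `ω₀ = dx ∧ dy =
r dr ∧ dϑ`: the corrected primitive restricts to `(r²/2 + κ) dϑ` on the punctured fibre, the
Hamiltonian field of `ν(r)` is `X_{ν(r)} = -(ν'(r)/r) ∂_ϑ`, "Hence `X_{ν(rᵢ)}(θ + df) < 0` for `r`
small enough because `κᵢ` is negative".  This file verifies that computation, with the sign
conventions of the tree (`ι_X ω₀ = dH` for the Hamiltonian field, `angular = d arg`):

* `extDeriv_halfAreaPrimitive_apply` — for `λ₀ = (x dy - y dx)/2`, written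
  `λ₀ z = ofSubsingleton ℝ ℂ ℝ 0 (2⁻¹ • (z.re • imCLM - z.im • reCLM))`, one has
  `dλ₀(u, v) = u₁ v₂ - u₂ v₁` (the area form `ω₀`), and `λ₀ = (r²/2) dϑ`
  (`halfAreaPrimitive_eq_smul_angular`);
* `extDeriv_angular_eq_zero` — `dϑ` is closed on `ℂ ∖ {0}` (it is `d arg`, resp.
  `d(arg(-·) + π)`, on the two slit planes), so `λ_κ = λ₀ + κ dϑ` is a primitive of `ω₀` on the
  punctured plane for every `κ` (`extDeriv_halfAreaPrimitive_add_smul_angular`);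
* `hasFDerivAt_normSq`, `extDeriv_halfAreaPrimitive_rotation` — the `ω₀`-dual of `d(r²)`
  (`r² = normSq`) is the rotation field `X = -2 I z = -2 ∂_ϑ`: `ω₀(X, v) = d(r²)(v)`;
* `halfAreaPrimitive_add_smul_angular_rotation` — **`λ_κ(X) = -(r² + 2κ)`**, hence
  `λ_κ(X) > 0` for `r² < -2κ` when `κ < 0` (`halfAreaPrimitive_add_smul_angular_rotation_pos`):
  McLean's positivity, in the form consumed by `exists_convex_of_local_correction`
  (`McleanDivisorComplementConvexFourGluing.lean`) once a fibre of the tube is identified with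
  `(𝔻_ε, ω₀)`.

Everything is proved; no definitions, no named facts (D-0026).

## References

* M. McLean, *The growth rate of symplectic homology and affine varieties*, Geom. Funct. Anal. 22
  (2012), Lemma 5.17, end of proof (p. 37). [Mclean2012]
-/

noncomputable section

open scoped Topology ContDiff Real
open Set Filter Complex ContinuousAlternatingMap

namespace Literature.Geometry.Symplectic

open Literature.Topology.FourManifolds (contDiffAt_arg)

/-! ### The primitive `λ₀ = (x dy - y dx)/2` of the area form -/

/-- Values of `λ₀ = (x dy - y dx)/2`: `λ₀_z(v) = (z₁ v₂ - z₂ v₁)/2`. [folklore] -/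
theorem halfAreaPrimitive_apply (z v : ℂ) :
    ofSubsingleton ℝ ℂ ℝ (0 : Fin 1) ((2 : ℝ)⁻¹ • (z.re • imCLM - z.im • reCLM)) ![v] =
      (z.re * v.im - z.im * v.re) / 2 := by
  change (2 : ℝ)⁻¹ • (z.re • v.im - z.im • v.re) = _
  simp only [smul_eq_mul]
  ring

/-- `λ₀ = (r²/2) dϑ` on the punctured plane (`r² = z₁² + z₂²`, `dϑ_z = Im(z⁻¹ ·)`; McLean's
"`(rᵢ²/2) dϑᵢ`"). [cite: Mclean2012, Lemma 5.17 (proof)] -/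
theorem halfAreaPrimitive_eq_smul_angular {z : ℂ} (hz : z ≠ 0) :
    ofSubsingleton ℝ ℂ ℝ (0 : Fin 1) ((2 : ℝ)⁻¹ • (z.re • imCLM - z.im • reCLM)) =
      (normSq z / 2) • ofSubsingleton ℝ ℂ ℝ (0 : Fin 1) (imCLM.comp (z⁻¹ • (1 : ℂ →L[ℝ] ℂ))) := by
  ext v
  have hv : v = ![v 0] := funext fun i ↦ by fin_cases i; rfl
  rw [hv, ContinuousAlternatingMap.smul_apply, halfAreaPrimitive_apply, angular_apply, smul_eq_mul,
    normSq_apply]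
  have h0 : normSq z ≠ 0 := (map_ne_zero normSq).2 hz
  have h : z.re ^ 2 + z.im ^ 2 ≠ 0 := by
    rw [normSq_apply] at h0
    convert h0 using 1
    ring
  field_simp

/-- `λ₀` is a continuous linear function of the point, hence differentiable with constant
derivative `u ↦ λ₀_u`. [folklore] -/
theorem hasFDerivAt_halfAreaPrimitive (z : ℂ) :
    HasFDerivAt
      (fun w : ℂ ↦ ofSubsingleton ℝ ℂ ℝ (0 : Fin 1) ((2 : ℝ)⁻¹ • (w.re • imCLM - w.im • reCLM)))
      ((ofSubsingletonLIE (𝕜 := ℝ) (E := ℂ) (F := ℝ) (0 : Fin 1)).toContinuousLinearEquiv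
        |>.toContinuousLinearMap.comp
        ((2 : ℝ)⁻¹ •
          (reCLM.smulRight (imCLM : ℂ →L[ℝ] ℝ) - imCLM.smulRight (reCLM : ℂ →L[ℝ] ℝ))))
      z := by
  set L : ℂ →L[ℝ] (ℂ →L[ℝ] ℝ) :=
    (2 : ℝ)⁻¹ • (reCLM.smulRight (imCLM : ℂ →L[ℝ] ℝ) - imCLM.smulRight (reCLM : ℂ →L[ℝ] ℝ))
    with hL
  have hLw : ∀ w : ℂ, L w = (2 : ℝ)⁻¹ • (w.re • imCLM - w.im • reCLM) := fun w ↦ by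
    simp [hL]
  have h : (fun w : ℂ ↦ ofSubsingleton ℝ ℂ ℝ (0 : Fin 1)
        ((2 : ℝ)⁻¹ • (w.re • imCLM - w.im • reCLM))) =
      fun w ↦ ((ofSubsingletonLIE (𝕜 := ℝ) (E := ℂ) (F := ℝ) (0 : Fin 1)).toContinuousLinearEquiv
        |>.toContinuousLinearMap.comp L) w := by
    funext w
    rw [ContinuousLinearMap.comp_apply, hLw]
    rfl
  rw [h]
  exact ContinuousLinearMap.hasFDerivAt _

/-- Mathlib's alternatization in degree `1 → 2` on a pair: `Alt f (u, v) = f u (v) - f v (u)`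
(private copy, for `E = ℂ`, of the tree's
`Literature.Geometry.Symplectic.alternatizeUncurryFin_apply_two` of `SteinSeamForms.lean`, to
keep the imports of this flat file light). [folklore] -/
private theorem alternatizeUncurryFin_apply_two' (f : ℂ →L[ℝ] (ℂ [⋀^Fin 1]→L[ℝ] ℝ)) (u v : ℂ) :
    alternatizeUncurryFin f ![u, v] = f u ![v] - f v ![u] := by
  rw [alternatizeUncurryFin_apply, Fin.sum_univ_two]
  have h0 : Fin.removeNth (0 : Fin 2) ![u, v] = ![v] := by
    funext i; fin_cases i; rfl
  have h1 : Fin.removeNth (1 : Fin 2) ![u, v] = ![u] := by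
    funext i; fin_cases i; rfl
  simp only [h0, h1, Fin.val_zero, Fin.val_one, pow_zero, pow_one, one_smul, neg_smul,
    Matrix.cons_val_zero, Matrix.cons_val_one, sub_eq_add_neg]

/-- **`dλ₀ = ω₀ = dx ∧ dy`**: `dλ₀_z(u, v) = u₁ v₂ - u₂ v₁` (Mathlib's normalisation of `d`).
[folklore] -/
theorem extDeriv_halfAreaPrimitive_apply (z u v : ℂ) :
    extDeriv (fun w : ℂ ↦ ofSubsingleton ℝ ℂ ℝ (0 : Fin 1)
      ((2 : ℝ)⁻¹ • (w.re • imCLM - w.im • reCLM))) z ![u, v] = u.re * v.im - u.im * v.re := by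
  set Λ : ℂ →L[ℝ] (ℂ [⋀^Fin 1]→L[ℝ] ℝ) :=
    (ofSubsingletonLIE (𝕜 := ℝ) (E := ℂ) (F := ℝ) (0 : Fin 1)).toContinuousLinearEquiv
      |>.toContinuousLinearMap.comp
      ((2 : ℝ)⁻¹ • (reCLM.smulRight (imCLM : ℂ →L[ℝ] ℝ) - imCLM.smulRight (reCLM : ℂ →L[ℝ] ℝ)))
    with hΛ
  have hΛw : ∀ a b : ℂ, Λ a ![b] = (a.re * b.im - a.im * b.re) / 2 := fun a b ↦ by
    rw [← halfAreaPrimitive_apply a b]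
    rfl
  rw [extDeriv, (hasFDerivAt_halfAreaPrimitive z).fderiv, ← hΛ, alternatizeUncurryFin_apply_two',
    hΛw, hΛw]
  ring

/-! ### `dϑ` is closed on the punctured plane -/

/-- `2 ≤ ∞` for Mathlib's `minSmoothness` over `ℝ`. [folklore] -/
theorem minSmoothness_two_le_infty : minSmoothness ℝ 2 ≤ ∞ := by
  rw [minSmoothness_of_isRCLikeNormedField]
  exact WithTop.coe_le_coe.2 le_top

/-- **The angular form is closed on `ℂ ∖ {0}`**: `d(dϑ) = 0` there, since `dϑ = d arg` on the
slit plane and `dϑ = d(arg(-·) + π)` on the opposite slit plane (`d ∘ d = 0`). [folklore] -/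
theorem extDeriv_angular_eq_zero {z : ℂ} (hz : z ≠ 0) :
    extDeriv (fun x : ℂ ↦ ofSubsingleton ℝ ℂ ℝ (0 : Fin 1)
      (imCLM.comp (x⁻¹ • (1 : ℂ →L[ℝ] ℂ)))) z = 0 := by
  rcases mem_slitPlane_or_neg_mem_slitPlane hz with h | h
  · have hev : (fun x : ℂ ↦ ofSubsingleton ℝ ℂ ℝ (0 : Fin 1) (imCLM.comp (x⁻¹ • (1 : ℂ →L[ℝ] ℂ))))
        =ᶠ[𝓝 z] extDeriv (fun x ↦ constOfIsEmpty ℝ ℂ (Fin 0) (arg x)) :=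
      eventually_of_mem (isOpen_slitPlane.mem_nhds h) fun w hw ↦
        (extDeriv_constOfIsEmpty_eq_of_hasFDerivAt (hasFDerivAt_arg hw)).symm
    rw [hev.extDeriv_eq]
    exact extDeriv_extDeriv_apply (contDiffAt_constOfIsEmpty (contDiffAt_arg h))
      minSmoothness_two_le_infty
  · have hev : (fun x : ℂ ↦ ofSubsingleton ℝ ℂ ℝ (0 : Fin 1) (imCLM.comp (x⁻¹ • (1 : ℂ →L[ℝ] ℂ))))
        =ᶠ[𝓝 z] extDeriv (fun x ↦ constOfIsEmpty ℝ ℂ (Fin 0) (arg (-x) + π)) :=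
      eventually_of_mem (isOpen_slitPlane.neg.mem_nhds h) fun w hw ↦
        (extDeriv_constOfIsEmpty_eq_of_hasFDerivAt (hasFDerivAt_arg_neg_add_pi hw)).symm
    rw [hev.extDeriv_eq]
    exact extDeriv_extDeriv_apply (contDiffAt_constOfIsEmpty (contDiffAt_arg_neg_add_pi h))
      minSmoothness_two_le_infty

/-- The angular form is differentiable at the points of `ℂ ∖ {0}` (it is locally `d` of a smooth
angle branch). [folklore] -/
theorem differentiableAt_angular {z : ℂ} (hz : z ≠ 0) :
    DifferentiableAt ℝ (fun x : ℂ ↦ ofSubsingleton ℝ ℂ ℝ (0 : Fin 1)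
      (imCLM.comp (x⁻¹ • (1 : ℂ →L[ℝ] ℂ)))) z := by
  -- locally `dϑ = dΘ` for a `C^∞` angle branch `Θ`, and `dΘ = Alt ∘ DΘ` is `C^∞`
  have key : ∀ {Θ : ℂ → ℝ} {O : Set ℂ}, IsOpen O → z ∈ O → (∀ w ∈ O, ContDiffAt ℝ ∞ Θ w) →
      (∀ w ∈ O, HasFDerivAt Θ (imCLM.comp (w⁻¹ • (1 : ℂ →L[ℝ] ℂ))) w) →
      DifferentiableAt ℝ (fun x : ℂ ↦ ofSubsingleton ℝ ℂ ℝ (0 : Fin 1)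
        (imCLM.comp (x⁻¹ • (1 : ℂ →L[ℝ] ℂ)))) z := by
    intro Θ O hO hzO hΘ hdΘ
    have hev : (fun x : ℂ ↦ ofSubsingleton ℝ ℂ ℝ (0 : Fin 1) (imCLM.comp (x⁻¹ • (1 : ℂ →L[ℝ] ℂ))))
        =ᶠ[𝓝 z] extDeriv (fun x ↦ constOfIsEmpty ℝ ℂ (Fin 0) (Θ x)) :=
      eventually_of_mem (hO.mem_nhds hzO) fun w hw ↦
        (extDeriv_constOfIsEmpty_eq_of_hasFDerivAt (hdΘ w hw)).symm
    have hc : ContDiffAt ℝ ∞ (extDeriv fun x ↦ constOfIsEmpty ℝ ℂ (Fin 0) (Θ x)) z := by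
      have hf := (contDiffAt_constOfIsEmpty (hΘ z hzO)).fderiv_right (m := ∞) (by simp)
      exact (alternatizeUncurryFinCLM ℝ ℂ ℝ).contDiff.contDiffAt.comp z hf
    exact (hc.differentiableAt (by simp)).congr_of_eventuallyEq hev
  rcases mem_slitPlane_or_neg_mem_slitPlane hz with h | h
  · exact key isOpen_slitPlane h (fun w hw ↦ contDiffAt_arg hw) fun w hw ↦ hasFDerivAt_arg hw
  · exact key isOpen_slitPlane.neg h (fun w hw ↦ contDiffAt_arg_neg_add_pi hw)
      fun w hw ↦ hasFDerivAt_arg_neg_add_pi hw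

/-- **`λ_κ = λ₀ + κ dϑ = (r²/2 + κ) dϑ` is a primitive of `ω₀` on `ℂ ∖ {0}`** for every real
`κ` (McLean's fibrewise normal form `(θ + df)|_{𝔻_ε ∖ 0} = (r²/2 + κ) dϑ`).
[cite: Mclean2012, Lemma 5.17 (proof)] -/
theorem extDeriv_halfAreaPrimitive_add_smul_angular (κ : ℝ) {z : ℂ} (hz : z ≠ 0) :
    extDeriv ((fun w : ℂ ↦ ofSubsingleton ℝ ℂ ℝ (0 : Fin 1)
        ((2 : ℝ)⁻¹ • (w.re • imCLM - w.im • reCLM))) +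
      κ • fun x : ℂ ↦ ofSubsingleton ℝ ℂ ℝ (0 : Fin 1) (imCLM.comp (x⁻¹ • (1 : ℂ →L[ℝ] ℂ)))) z =
    extDeriv (fun w : ℂ ↦ ofSubsingleton ℝ ℂ ℝ (0 : Fin 1)
        ((2 : ℝ)⁻¹ • (w.re • imCLM - w.im • reCLM))) z := by
  rw [extDeriv_add (hasFDerivAt_halfAreaPrimitive z).differentiableAt
      ((differentiableAt_angular hz).const_smul κ), extDeriv_smul, extDeriv_angular_eq_zero hz,
    smul_zero, add_zero]

/-! ### The rotation field `X = -2 I z = -2 ∂_ϑ` is the `ω₀`-dual of `d(r²)` -/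

/-- `d(r²)_z (v) = 2 (z₁ v₁ + z₂ v₂)` for `r² = normSq`. [folklore] -/
theorem hasFDerivAt_normSq (z : ℂ) :
    HasFDerivAt normSq ((2 * z.re) • (reCLM : ℂ →L[ℝ] ℝ) + (2 * z.im) • (imCLM : ℂ →L[ℝ] ℝ)) z := by
  have h : (normSq : ℂ → ℝ) = fun w ↦ w.re * w.re + w.im * w.im := funext fun w ↦ normSq_apply w
  rw [h]
  have h2 := (reCLM.hasFDerivAt.mul reCLM.hasFDerivAt (x := z)).add
    (imCLM.hasFDerivAt.mul imCLM.hasFDerivAt (x := z))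
  refine h2.congr_fderiv ?_
  ext v
  simp only [_root_.add_apply, _root_.smul_apply, reCLM_apply, imCLM_apply, smul_eq_mul]
  ring

/-- **The Hamiltonian field of `r²` is `-2∂_ϑ`**: for `X = -2 I z` one has
`ω₀(X, v) = d(r²)_z(v)` for all `v` (`ι_X ω₀ = d(r²)`; McLean: "`X_{ν(rᵢ)}` restricted to a
fibre … is equal to `-(ν'(rᵢ)/rᵢ) ∂/∂ϑᵢ`", here `ν = r²`). [cite: Mclean2012, Lemma 5.17 (proof)] -/
theorem extDeriv_halfAreaPrimitive_rotation (z v : ℂ) :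
    extDeriv (fun w : ℂ ↦ ofSubsingleton ℝ ℂ ℝ (0 : Fin 1)
      ((2 : ℝ)⁻¹ • (w.re • imCLM - w.im • reCLM))) z ![-2 * I * z, v] =
      ((2 * z.re) • (reCLM : ℂ →L[ℝ] ℝ) + (2 * z.im) • (imCLM : ℂ →L[ℝ] ℝ)) v := by
  rw [extDeriv_halfAreaPrimitive_apply]
  simp only [_root_.add_apply, _root_.smul_apply, reCLM_apply, imCLM_apply, smul_eq_mul, mul_re,
    mul_im, neg_re, neg_im, I_re, I_im, re_ofNat, im_ofNat, neg_mul]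
  ring

/-! ### McLean's positivity: `λ_κ(X) = -(r² + 2κ)` -/

/-- **`λ_κ(-2∂_ϑ) = -(r² + 2κ)`**: the value of `λ_κ = λ₀ + κ dϑ = (r²/2 + κ) dϑ` on the
Hamiltonian field `X = -2 I z` of `r²` is `-(normSq z + 2κ)` (McLean: `X_{ν(r)}(θ + df) < 0 …
because `κ` is negative`; equivalently `(θ + df)(X_{r²}) > 0` near the divisor).
[cite: Mclean2012, Lemma 5.17 (proof)] -/
theorem halfAreaPrimitive_add_smul_angular_rotation (κ : ℝ) {z : ℂ} (hz : z ≠ 0) :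
    (ofSubsingleton ℝ ℂ ℝ (0 : Fin 1) ((2 : ℝ)⁻¹ • (z.re • imCLM - z.im • reCLM)) +
      κ • ofSubsingleton ℝ ℂ ℝ (0 : Fin 1) (imCLM.comp (z⁻¹ • (1 : ℂ →L[ℝ] ℂ)))) ![-2 * I * z] =
      -(normSq z + 2 * κ) := by
  rw [ContinuousAlternatingMap.add_apply, ContinuousAlternatingMap.smul_apply,
    halfAreaPrimitive_apply, angular_apply, smul_eq_mul, normSq_apply]
  simp only [mul_re, mul_im, neg_re, neg_im, I_re, I_im, re_ofNat, im_ofNat, neg_mul]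
  have h0 : normSq z ≠ 0 := (map_ne_zero normSq).2 hz
  have h : z.re ^ 2 + z.im ^ 2 ≠ 0 := by
    rw [normSq_apply] at h0
    convert h0 using 1
    ring
  field_simp
  ring

/-- **McLean's positivity near the divisor**: for `κ < 0` and `0 < r² < -2κ`,
`λ_κ(X) > 0` for the Hamiltonian field `X = -2 I z` of `r²`.
[cite: Mclean2012, Lemma 5.17 (proof)] -/
theorem halfAreaPrimitive_add_smul_angular_rotation_pos {κ : ℝ} {z : ℂ} (hz : z ≠ 0)
    (hr : normSq z < -2 * κ) :
    0 < (ofSubsingleton ℝ ℂ ℝ (0 : Fin 1) ((2 : ℝ)⁻¹ • (z.re • imCLM - z.im • reCLM)) +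
      κ • ofSubsingleton ℝ ℂ ℝ (0 : Fin 1) (imCLM.comp (z⁻¹ • (1 : ℂ →L[ℝ] ℂ)))) ![-2 * I * z] := by
  rw [halfAreaPrimitive_add_smul_angular_rotation κ hz]
  linarith

end Literature.Geometry.Symplectic
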